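import Summits.Ventures.PercRepro.PerPlaneClosing

/-!
# PercRepro — Theorem O, Step 3: the two inequalities of a simple plane (p2, gen 5)

`proofs/MINE2-RLS.md` §16 Step 3.  For a plane `G` (rank-3 flat) of a simple matroid with `g = |G|` points,
`T / LP / R` the counts of `PerPlaneClosing.lean` and `g′ = #{a ∈ G : ρ(G ∖ {a}) = 3}`:

* `R + LP ≥ T·σ(g)`, `σ(g) := Σ_{s=4}^{g} C(g−3, s−3)/C(s, 3)` — every independent triple of `G` lies in
  `C(g−3, s−3)` `s`-subsets of `G`, all of rank `3`, and a rank-3 `s`-set holds at most `C(s, 3)` independent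
  triples (`double counting `Finset.card_mul_le_card_mul`);
* `g′ ≥ g − 1` for `g ≥ 4` (two points `a ≠ b` with `ρ(G ∖ {a}), ρ(G ∖ {b}) ≤ 2` would put `G` on the line through
  `G ∖ {a, b}`), `T ≤ C(g, 3)`;
* hence **(α)** `T ≤ 3·LP + 11·R + 5` (`σ(g) ≥ 3/5` for `g ≥ 5`, `g ≤ 4` by hand) and
  **(β)** `2·T ≤ LP + 7·R + 5 + 5·g′` (`σ(g) ≥ 2` for `g ≥ 8`, `g ≤ 7` by the table `C(g,3)·(2 − σ(g)) ≤ 5g`).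

With `PerPlaneClosing.five_quarter_mul_card_U_le` this closes Step 2 of Theorem O:
`five_quarter_mul_card_U_le'`.  Imports Mathlib and the three plane files.
-/

namespace PercRepro

namespace ThmO

open Finset ThmH

variable {α : Type*} [DecidableEq α] {M : Matroid α} [M.Finite]

/-- `σ(g) = Σ_{s=4}^{g} C(g−3, s−3)/C(s, 3)`. -/
noncomputable def sigma (g : ℕ) : ℚ := ∑ s ∈ Finset.Icc 4 g, ((g - 3).choose (s - 3) : ℚ) / (s.choose 3 : ℚ)

open scoped Classical in
/-- The rank-3 `s`-subsets of `G`. -/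
noncomputable def Ns (M : Matroid α) [M.Finite] (G : Finset α) (s : ℕ) : Finset (Finset α) :=
  (N3 M G).filter (fun B => B.card = s)

omit [DecidableEq α] in
/-- Every subset of a plane containing an independent triple has rank `3`. -/
theorem eRk_eq_three_of_subset {G τ B : Finset α} (hG : G ∈ planes M) (hτ : τ ∈ N3 M G) (hτB : τ ⊆ B)
    (hBG : B ⊆ G) : M.eRk (B : Set α) = 3 := by
  simp only [N3, Finset.mem_filter, Finset.mem_powerset] at hτ
  apply le_antisymm
  · rw [← (mem_planes.1 hG).2.2]; exact M.eRk_mono (Finset.coe_subset.2 hBG)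
  · rw [← hτ.2]; exact M.eRk_mono (Finset.coe_subset.2 hτB)

/-- **The double count**: `T · C(g−3, s−3) ≤ N_s · C(s, 3)` for every `s`. -/
theorem Tc_mul_choose_le {G : Finset α} (hG : G ∈ planes M) {s : ℕ} (hs4 : 4 ≤ s) :
    Tc M G * (G.card - 3).choose (s - 3) ≤ (Ns M G s).card * s.choose 3 := by
  classical
  unfold Tc
  refine Finset.card_mul_le_card_mul (fun τ B => τ ⊆ B) ?_ ?_
  · -- every independent triple has C(g−3, s−3) rank-3 s-supersets in G
    intro τ hτ
    rw [Finset.mem_filter] at hτ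
    obtain ⟨hτN, hτ3⟩ := hτ
    have hτG : τ ⊆ G := Finset.mem_powerset.1 (Finset.mem_filter.1 hτN).1
    have hcard : (G \ τ).card = G.card - 3 := by rw [Finset.card_sdiff_of_subset hτG, hτ3]
    rw [← hcard, ← Finset.card_powersetCard]
    refine Finset.card_le_card_of_injOn (fun X => τ ∪ X) ?_ ?_
    · intro X hX
      rw [Finset.mem_coe, Finset.mem_powersetCard] at hX
      rw [Finset.mem_coe, Finset.bipartiteAbove, Finset.mem_filter, Ns, Finset.mem_filter, N3,
        Finset.mem_filter, Finset.mem_powerset]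
      have hXτ : Disjoint τ X := by
        rw [Finset.disjoint_left]
        intro y hy hyX
        exact (Finset.mem_sdiff.1 (hX.1 hyX)).2 hy
      have hsub : τ ∪ X ⊆ G := Finset.union_subset hτG (hX.1.trans Finset.sdiff_subset)
      refine ⟨⟨⟨hsub, eRk_eq_three_of_subset hG hτN Finset.subset_union_left hsub⟩, ?_⟩,
        Finset.subset_union_left⟩
      rw [Finset.card_union_of_disjoint hXτ, hτ3, hX.2]
      omega
    · intro X hX X' hX' h
      rw [Finset.mem_coe, Finset.mem_powersetCard] at hX hX'
      simp only at h
      have hXτ : Disjoint τ X := by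
        rw [Finset.disjoint_left]
        intro y hy hyX
        exact (Finset.mem_sdiff.1 (hX.1 hyX)).2 hy
      have hXτ' : Disjoint τ X' := by
        rw [Finset.disjoint_left]
        intro y hy hyX
        exact (Finset.mem_sdiff.1 (hX'.1 hyX)).2 hy
      have e1 : (τ ∪ X) \ τ = X := by
        rw [Finset.union_sdiff_cancel_left]
        exact hXτ
      have e2 : (τ ∪ X') \ τ = X' := by
        rw [Finset.union_sdiff_cancel_left]
        exact hXτ'
      rw [← e1, ← e2, h]
  · -- a rank-3 s-set holds at most C(s, 3) triples
    intro B hB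
    rw [Ns, Finset.mem_filter] at hB
    have hsub : (N3 M G ∩ Finset.filter (fun τ => τ.card = 3) (N3 M G)).bipartiteBelow (fun τ B => τ ⊆ B) B ⊆
        B.powersetCard 3 := by
      intro τ hτ
      rw [Finset.bipartiteBelow, Finset.mem_filter, Finset.mem_inter, Finset.mem_filter] at hτ
      rw [Finset.mem_powersetCard]
      exact ⟨hτ.2, hτ.1.2.2⟩
    have := Finset.card_le_card hsub
    rw [Finset.card_powersetCard, hB.2] at this
    calc (((N3 M G).filter (fun τ => τ.card = 3)).bipartiteBelow (fun τ B => τ ⊆ B) B).card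
        ≤ ((N3 M G ∩ Finset.filter (fun τ => τ.card = 3) (N3 M G)).bipartiteBelow (fun τ B => τ ⊆ B) B).card := by
          apply Finset.card_le_card
          intro τ hτ
          rw [Finset.bipartiteBelow, Finset.mem_filter] at hτ ⊢
          exact ⟨Finset.mem_inter.2 ⟨(Finset.mem_filter.1 hτ.1).1, hτ.1⟩, hτ.2⟩
      _ ≤ s.choose 3 := this

/-! ### `R + LP ≥ T·σ(g)`, `g′ ≥ g − 1`, `T ≤ C(g, 3)` -/

/-- `LP + R = #{B ∈ N₃(G) : |B| ≠ 3}`. -/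
theorem LPc_add_Rc (M : Matroid α) [M.Finite] (G : Finset α) :
    LPc M G + Rc M G = ((N3 M G).filter (fun B => ¬ B.card = 3)).card := by
  classical
  unfold LPc Rc
  have h := Finset.card_filter_add_card_filter_not (s := (N3 M G).filter (fun B => ¬ B.card = 3))
    (fun B => (tieLines M G B).Nonempty)
  rw [Finset.filter_filter, Finset.filter_filter] at h
  exact h

omit [DecidableEq α] in
/-- `#{B ∈ N₃(G) : |B| ≠ 3} = Σ_{s=4}^{g} N_s`. -/
theorem card_N3_ne_three_eq_sum (G : Finset α) :
    ((N3 M G).filter (fun B => ¬ B.card = 3)).card = ∑ s ∈ Finset.Icc 4 G.card, (Ns M G s).card := by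
  classical
  have hmaps : ∀ B ∈ (N3 M G).filter (fun B => ¬ B.card = 3), B.card ∈ Finset.Icc 4 G.card := by
    intro B hB
    rw [Finset.mem_filter] at hB
    have hBN := hB.1
    simp only [N3, Finset.mem_filter, Finset.mem_powerset] at hBN
    have h3 := three_le_card_of_eRk_three hBN.2
    rw [Finset.mem_Icc]
    exact ⟨by omega, Finset.card_le_card hBN.1⟩
  rw [Finset.card_eq_sum_card_fiberwise hmaps]
  apply Finset.sum_congr rfl
  intro s hs
  rw [Finset.mem_Icc] at hs
  congr 1
  rw [Ns, Finset.filter_filter]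
  apply Finset.filter_congr
  intro B _
  constructor
  · exact fun h => h.2
  · intro h; exact ⟨by omega, h⟩

/-- `R + LP ≥ T·σ(g)`. -/
theorem LPc_add_Rc_ge {G : Finset α} (hG : G ∈ planes M) :
    (Tc M G : ℚ) * sigma G.card ≤ (LPc M G : ℚ) + Rc M G := by
  classical
  have h := LPc_add_Rc M G
  rw [card_N3_ne_three_eq_sum G] at h
  have h' : ((LPc M G : ℚ) + Rc M G) = ∑ s ∈ Finset.Icc 4 G.card, ((Ns M G s).card : ℚ) := by
    exact_mod_cast h
  rw [h', sigma, Finset.mul_sum]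
  apply Finset.sum_le_sum
  intro s hs
  rw [Finset.mem_Icc] at hs
  have hpos : (0 : ℚ) < (s.choose 3 : ℚ) := by exact_mod_cast Nat.choose_pos (by omega)
  rw [← mul_div_assoc, div_le_iff₀ hpos]
  exact_mod_cast Tc_mul_choose_le hG hs.1

omit [DecidableEq α] in
/-- `T ≤ C(g, 3)`. -/
theorem Tc_le_choose (M : Matroid α) [M.Finite] (G : Finset α) : Tc M G ≤ G.card.choose 3 := by
  classical
  unfold Tc
  rw [← Finset.card_powersetCard]
  apply Finset.card_le_card
  intro B hB
  rw [Finset.mem_filter, N3, Finset.mem_filter, Finset.mem_powerset] at hB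
  rw [Finset.mem_powersetCard]
  exact ⟨hB.1.1, hB.2⟩

/-- At most one point `a` of a plane with `g ≥ 4` points has `ρ(G ∖ {a}) ≤ 2`. -/
theorem card_bad_le_one (hs : Simple M) {G : Finset α} (hG : G ∈ planes M) (hg : 4 ≤ G.card) :
    (G.filter (fun a => ¬ M.eRk ((G.erase a : Finset α) : Set α) = 3)).card ≤ 1 := by
  classical
  rw [Finset.card_le_one]
  intro a ha b hb
  rw [Finset.mem_filter] at ha hb
  by_contra hab
  have hGE := (mem_planes.1 hG).1
  -- ρ(G ∖ {a}) ≤ 2 and ρ(G ∖ {b}) ≤ 2 (each is ≤ 3 = ρ(G) and ≠ 3)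
  have hle : ∀ c ∈ G, ¬ M.eRk ((G.erase c : Finset α) : Set α) = 3 → M.eRk ((G.erase c : Finset α) : Set α) ≤ 2 := by
    intro c hc hne
    have h3 : M.eRk ((G.erase c : Finset α) : Set α) ≤ 3 := by
      rw [← (mem_planes.1 hG).2.2]; exact M.eRk_mono (Finset.coe_subset.2 (Finset.erase_subset _ _))
    obtain ⟨k, hk, -⟩ := eRk_eq_nat M (G.erase c)
    rw [hk] at h3 hne ⊢
    have : k ≤ 3 := by exact_mod_cast h3
    have : k ≠ 3 := fun h => hne (by rw [h]; rfl)
    exact_mod_cast (show k ≤ 2 by omega)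
  have ha2 := hle a ha.1 ha.2
  have hb2 := hle b hb.1 hb.2
  -- submodularity on G ∖ {a} and G ∖ {b}: union = G, intersection = G ∖ {a, b} of rank ≥ 2
  have hunion : G.erase a ∪ G.erase b = G := by
    ext y
    simp only [Finset.mem_union, Finset.mem_erase]
    constructor
    · rintro (⟨-, hy⟩ | ⟨-, hy⟩) <;> exact hy
    · intro hy
      by_cases hya : y = a
      · subst hya; exact Or.inr ⟨hab, hy⟩
      · exact Or.inl ⟨hya, hy⟩
  have hinter : 2 ≤ M.eRk ((G.erase a ∩ G.erase b : Finset α) : Set α) := by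
    -- G ∖ {a, b} has at least two points
    have hc : 2 ≤ (G.erase a ∩ G.erase b).card := by
      have : G.erase a ∩ G.erase b = (G.erase a).erase b := by
        ext y; simp only [Finset.mem_inter, Finset.mem_erase]; tauto
      rw [this, Finset.card_erase_of_mem (Finset.mem_erase.2 ⟨fun h => hab h.symm, hb.1⟩),
        Finset.card_erase_of_mem ha.1]
      omega
    obtain ⟨c, hc', d, hd, hcd⟩ := Finset.one_lt_card.1 (show 1 < (G.erase a ∩ G.erase b).card by omega)
    exact two_le_eRk_of_two_mem hs ((Finset.inter_subset_left.trans (Finset.erase_subset _ _)).trans hGE) hc' hd hcd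
  have hsub := M.eRk_inter_add_eRk_union_le ((G.erase a : Finset α) : Set α) ((G.erase b : Finset α) : Set α)
  rw [← Finset.coe_inter, ← Finset.coe_union, hunion, (mem_planes.1 hG).2.2] at hsub
  have : (2 : ℕ∞) + 3 ≤ 2 + 2 := (add_le_add hinter (le_refl _)).trans (hsub.trans (add_le_add ha2 hb2))
  norm_num at this

/-- `g′ ≥ g − 1` for `g ≥ 4`. -/
theorem gp_ge (hs : Simple M) {G : Finset α} (hG : G ∈ planes M) (hg : 4 ≤ G.card) : G.card ≤ gp M G + 1 := by
  classical
  have h := Finset.card_filter_add_card_filter_not (s := G) (fun a => M.eRk ((G.erase a : Finset α) : Set α) = 3)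
  have hbad := card_bad_le_one hs hG hg
  unfold gp
  omega

/-! ### The values of `σ` and the two inequalities -/

/-- `σ(4) = 1/4`. -/
theorem sigma_four : sigma 4 = 1 / 4 := by
  unfold sigma
  rw [show Finset.Icc 4 4 = {4} from by decide, Finset.sum_singleton]
  norm_num [Nat.choose]

/-- `σ(5) = 3/5`. -/
theorem sigma_five : sigma 5 = 3 / 5 := by
  unfold sigma
  rw [show Finset.Icc 4 5 = {4, 5} from by decide, Finset.sum_pair (by norm_num)]
  norm_num [Nat.choose]

/-- `σ(6) = 11/10`. -/
theorem sigma_six : sigma 6 = 11 / 10 := by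
  unfold sigma
  rw [show Finset.Icc 4 6 = {4, 5, 6} from by decide, Finset.sum_insert (by decide), Finset.sum_pair (by norm_num)]
  norm_num [Nat.choose]

/-- `σ(7) = 64/35`. -/
theorem sigma_seven : sigma 7 = 64 / 35 := by
  unfold sigma
  rw [show Finset.Icc 4 7 = {4, 5, 6, 7} from by decide, Finset.sum_insert (by decide),
    Finset.sum_insert (by decide), Finset.sum_pair (by norm_num)]
  norm_num [Nat.choose]

/-- `σ(8) = 163/56`. -/
theorem sigma_eight : sigma 8 = 163 / 56 := by
  unfold sigma
  rw [show Finset.Icc 4 8 = {4, 5, 6, 7, 8} from by decide, Finset.sum_insert (by decide),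
    Finset.sum_insert (by decide), Finset.sum_insert (by decide), Finset.sum_pair (by norm_num)]
  norm_num [Nat.choose]

/-- `σ` is nondecreasing. -/
theorem sigma_mono {g g' : ℕ} (h : g ≤ g') : sigma g ≤ sigma g' := by
  unfold sigma
  calc ∑ s ∈ Finset.Icc 4 g, ((g - 3).choose (s - 3) : ℚ) / (s.choose 3 : ℚ)
      ≤ ∑ s ∈ Finset.Icc 4 g, ((g' - 3).choose (s - 3) : ℚ) / (s.choose 3 : ℚ) := by
        apply Finset.sum_le_sum
        intro s _
        apply div_le_div_of_nonneg_right _ (by positivity)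
        exact_mod_cast Nat.choose_le_choose (s - 3) (by omega)
    _ ≤ ∑ s ∈ Finset.Icc 4 g', ((g' - 3).choose (s - 3) : ℚ) / (s.choose 3 : ℚ) := by
        apply Finset.sum_le_sum_of_subset_of_nonneg
        · intro s hs; rw [Finset.mem_Icc] at hs ⊢; omega
        · intro s _ _; positivity


/-- **(α)**: `T ≤ 3·LP + 11·R + 5` for every plane of a simple matroid. -/
theorem alpha_ineq {G : Finset α} (hG : G ∈ planes M) :
    (Tc M G : ℚ) ≤ 3 * LPc M G + 11 * Rc M G + 5 := by
  have hLR := LPc_add_Rc_ge hG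
  have hT0 : (0 : ℚ) ≤ Tc M G := by positivity
  have hL0 : (0 : ℚ) ≤ LPc M G := by positivity
  have hR0 : (0 : ℚ) ≤ Rc M G := by positivity
  rcases le_or_gt 5 G.card with h5 | h4
  · have hσ : (3 / 5 : ℚ) ≤ sigma G.card := by rw [← sigma_five]; exact sigma_mono h5
    nlinarith
  · have hT : Tc M G ≤ 4 := by
      have := Tc_le_choose M G
      have h' : G.card.choose 3 ≤ Nat.choose 4 3 := Nat.choose_le_choose 3 (by omega)
      have h4' : Nat.choose 4 3 = 4 := by decide
      omega
    have : (Tc M G : ℚ) ≤ 4 := by exact_mod_cast hT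
    linarith

/-- **(β)**: `2·T ≤ LP + 7·R + 5 + 5·g′` for every plane of a simple matroid. -/
theorem beta_ineq (hs : Simple M) {G : Finset α} (hG : G ∈ planes M) :
    2 * (Tc M G : ℚ) ≤ LPc M G + 7 * Rc M G + 5 + 5 * gp M G := by
  have hLR := LPc_add_Rc_ge hG
  have hT0 : (0 : ℚ) ≤ Tc M G := by positivity
  have hL0 : (0 : ℚ) ≤ LPc M G := by positivity
  have hR0 : (0 : ℚ) ≤ Rc M G := by positivity
  have hg0 : (0 : ℚ) ≤ gp M G := by positivity
  rcases le_or_gt 8 G.card with h8 | h7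
  · have hσ : (2 : ℚ) ≤ sigma G.card := by
      have := sigma_mono h8
      rw [sigma_eight] at this
      linarith
    nlinarith
  rcases lt_or_ge G.card 4 with h3 | h4
  · have hT : Tc M G ≤ 1 := by
      have := Tc_le_choose M G
      have h' : G.card.choose 3 ≤ Nat.choose 3 3 := Nat.choose_le_choose 3 (by omega)
      have h3' : Nat.choose 3 3 = 1 := by decide
      omega
    have : (Tc M G : ℚ) ≤ 1 := by exact_mod_cast hT
    linarith
  · have hgp := gp_ge hs hG h4
    have hgp' : (G.card : ℚ) ≤ gp M G + 1 := by exact_mod_cast hgp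
    have hTc := Tc_le_choose M G
    have hTc' : (Tc M G : ℚ) ≤ (G.card.choose 3 : ℚ) := by exact_mod_cast hTc
    interval_cases hg : G.card <;> push_cast at hgp'
    · rw [sigma_four] at hLR
      have : (Nat.choose 4 3 : ℚ) = 4 := by norm_num [Nat.choose]
      rw [this] at hTc'
      nlinarith
    · rw [sigma_five] at hLR
      have : (Nat.choose 5 3 : ℚ) = 10 := by norm_num [Nat.choose]
      rw [this] at hTc'
      nlinarith
    · rw [sigma_six] at hLR
      have : (Nat.choose 6 3 : ℚ) = 20 := by norm_num [Nat.choose]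
      rw [this] at hTc'
      nlinarith
    · rw [sigma_seven] at hLR
      have : (Nat.choose 7 3 : ℚ) = 35 := by norm_num [Nat.choose]
      rw [this] at hTc'
      nlinarith

/-- **Theorem O, Step 2, unconditional**: for a simple matroid with `ρ(E) ≥ 5`, coloop-free when `ρ(E) = 5`,
`(5/4)·#U′ ≤ #Y`. -/
theorem five_quarter_mul_card_U_le' (hs : Simple M) (hpE : (5 : ℕ∞) ≤ M.eRank)
    (hcol : M.eRank = 5 → ∀ e, ¬ M.IsColoop e) :
    (5 / 4 : ℚ) * ((U M).card : ℚ) ≤ ((Y M).card : ℚ) :=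
  five_quarter_mul_card_U_le hpE hcol hs (fun _ hG => ⟨alpha_ineq hG, beta_ineq hs hG⟩)

end ThmO

end PercRepro
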